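import Literature.NumberTheory.Irrationality.PAdicZetaValues.Basic
import Mathlib.LinearAlgebra.Dimension.Finrank
import HarnessLib

/-!
# `p`-adic Hurwitz zeta values `ζ_p(s, x)` (Cohen's Volkenborn form) and the printed irrationality results on them

Topic `Literature/NumberTheory/Irrationality/PAdicZetaValues`. DEFINITIONS (with bodies) + NAMED FACTS (statements only),
closing part of the gap recorded in `Basic.lean`/`Records.lean`: the statements of the `p`-adic strand that are printed
for values of the `p`-adic HURWITZ zeta function `ζ_p(s, x)` (`s ≥ 2` an integer, `x ∈ ℚ_p`, `|x|_p ≥ q_p`). Sources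
(held as text):

* J. Sprang, Duke Math. J. 169 (2020) = arXiv:1809.07714 [Sprang2020], §3 (p. 8): "`q_p := p` if `p ≠ 2`, `4` if
  `p = 2`. … The units `ℤ_p^×` decompose canonically `ℤ_p^× ≅ μ_{φ(q_p)}(ℤ_p) × (1 + q_p ℤ_p)` … The canonical projection
  `ω : ℤ_p^× → μ_{φ(q_p)}(ℤ_p)` is called the Teichmüller character. Let us extend the Teichmüller character to a map
  `ℚ_p^× → ℚ_p^×` by setting `ω(x) := p^{ν_p(x)} ω(x/p^{ν_p(x)})`, and define `⟨x⟩ := x/ω(x)` for `x ∈ ℚ_p^×`. Let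
  `x ∈ ℚ_p` be given with `|x|_p ≥ q_p`. … Explicitly, the function `ζ_p(s, x)` can be defined by a Volkenborn
  integral, see [cohen2]: `ζ_p(s, x) = (1/(s−1)) ∫_{ℤ_p} ⟨x + t⟩^{1−s} dt`", and (proof of Lemma 3.1) "Unravelling the
  definition of the Volkenborn integral … gives `ζ_p(s, x) = (1/(s−1)) lim_{r→∞} p^{−r} Σ_{0 ≤ m < p^r} ⟨x + m⟩^{1−s}`";
  **Lemma 3.1**: "Let `s > 1` be an integer and `x ∈ ℚ_p` with `|x|_p ≥ q_p`, then
  `ω(x)^{1−s} ζ_p(s, x) = (1/(s−1)) ∫_{ℤ_p} (x + t)^{1−s} dt`"; §1 **Theorem 1.3**: "Let `x ∈ ℚ` with `|x|_p > 1`. For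
  `ε > 0` and `s` sufficiently large, we have `dim_K(K + ζ_p(2, x) K + ⋯ + ζ_p(s, x) K) ≥ (1−ε) log s/(2[K:ℚ](1 + log 2))`."
* L. Lai, Int. J. Number Theory 21 (2025) = arXiv:2304.00816 [Lai2025TwoAdicZeta], §2.3 (the same definitions, after
  [Coh07]: "`ω(x) := p^{v_p(x)} ω(x/p^{v_p(x)})` and define `⟨x⟩ := x/ω(x)` … For … `x ∈ ℚ_p` such that `|x|_p ≥ q_p`,
  we define `ζ_p(s, x) := (1/(s−1)) ∫_{ℤ_p} ⟨t + x⟩^{1−s} dt`"; "**Lemma 2.7.** For any odd integer `j ≥ 3`, we have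
  `ζ_p(j) = (1/q_p) Σ_{a=0, p∤a}^{q_p−1} ω(a)^{1−j} ζ_p(j, a/q_p) = (2/q_p) Σ_{0<a<q_p/2} ω(a)^{1−j} ζ_p(j, a/q_p)`. In
  particular, for any odd integer `j ≥ 3` we have `ζ_2(j) = ½ ζ_2(j, ¼)`"); §1: "**Theorem 1.2.** For any nonnegative
  integer `s` and any `δ ∈ {0, 1}`, the following set contains at least one irrational number:
  `{ζ_2(j, ¼) | j ∈ ℤ ∩ [s+3, 3s+5], j ≡ δ (mod 2)}`." "**Theorem 1.3.** For any nonnegative integer `s`, the following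
  set contains at least one irrational number: `{ζ_2(j, ¼) | j ∈ ℤ ∩ [s+3, 2s+3]}`. The special case `s = 0` of Theorem 1.3
  gives an alternative proof of the irrationality of `ζ_2(3)`."

## Contents

* `qp p = q_p` (`4` for `p = 2`, else `p`).
* `teichmullerUnit p u` — the Teichmüller representative of a unit `u ∈ ℤ_p^×`: for odd `p` the `(p−1)`-st root of
  unity `lim_k u^{p^k} ≡ u (mod p)` (the tree's `PAdicPolylogarithms.padicTeichmuller` is this limit for every `p`; it is
  NOT reused because for `p = 2` the printed `ω` is the character modulo `q_2 = 4` with values `±1`, `ω(u) ≡ u (mod 4)`,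
  whereas `lim u^{2^k} = 1`); for `p = 2`: `1` if `|u − 1|_2 < ½` (i.e. `u ≡ 1 (mod 4)`), else `−1`.
* `teichmuller p x = ω(x) = p^{ν_p(x)} ω(x/p^{ν_p(x)})` on `ℚ_p^×` (junk at `0`), `angle p x = ⟨x⟩ = x/ω(x)`.
* `padicHurwitzZeta p s x = ζ_p(s, x) := (1/(s−1)) lim_{r→∞} p^{−r} Σ_{0≤m<p^r} ⟨x + m⟩^{1−s}` (`limUnder atTop`; intended
  for integers `s ≥ 2` and `|x|_p ≥ q_p`, junk otherwise or if divergent — convergence = Volkenborn integrability of the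
  locally analytic integrand, [Lai2025TwoAdicZeta, §2.2], not proved here).
* NAMED FACTS: `sprang2020_lemma31` (`ω(x)^{1−s} ζ_p(s,x) = (1/(s−1)) lim_r p^{−r} Σ_{m<p^r} (x+m)^{1−s}`),
  `lai2025TwoAdic_lemma27` / `lai2025TwoAdic_lemma27_two` (`ζ_p(j)` of `Basic.lean` through Hurwitz values; `ζ_2(j) = ½ ζ_2(j, ¼)`),
  `lai2025TwoAdic_theorem12`, `lai2025TwoAdic_theorem13`, `sprang2020_theorem13_rat` (`K = ℚ`; the printed hypothesis
  `|x|_p > 1` is taken on the domain of definition `|x|_p ≥ q_p` of §3 — the same condition for odd `p`, and for `p = 2`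
  a restriction, so nothing stronger than printed is asserted).

NUMERICAL CHECK (seat folder, exact rational arithmetic): with `⟨m + ¼⟩ = 4m + 1` in `ℚ_2` the Riemann sums
`2^{−r} Σ_{m<2^r} (4m+1)^{−2}` are 2-adically Cauchy (`v_2` of successive differences `7, 8, 9, …`) and
`½ · ½ · lim` agrees with the `Basic.lean` sequence for `ζ_2(3)` to 2-adic orders `0, 1, 2, 3, 4` along `N = 0, …, 4`
(Lemma 2.7 at `j = 3`).

NOT typed (still gaps): [Beukers2008] Cor. 14/18/22/23 and [Calegari2005, Thm 4.2] (stated for Washington's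
`H_p(s, a, F)` / `L_p(s, 𝟙)` — e.g. "`ζ_2(2)`" there is `L_2(2, 𝟙) ≠ L_2(2, ω^{−1}) = 0`), Bel 2010 Thms 1–2 (Lerch-type
combinations `T̃_p(s, x)` over `ℚ(χ)`), [Sprang2020, Thm 1.1] (`L_p(i, χω^{1−i})` for a general Dirichlet character).

Cell zeta5-irr (HONEST FRAMING): RECORD vocabulary/entries; nothing about `ζ(5) ∈ ℝ`.
-/

noncomputable section

open Filter
open scoped Topology

namespace Literature.NumberTheory.Irrationality.PAdicZetaValues

variable (p : ℕ) [Fact p.Prime]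

/-! ### Teichmüller character, `⟨x⟩`, and `ζ_p(s, x)` -/

/-- `q_p := p` if `p ≠ 2`, `4` if `p = 2`. [cite: Sprang2020, §3 (display before Lemma 3.1)] [cite: Lai2025TwoAdicZeta, §2.3] -/
def qp : ℕ := if p = 2 then 4 else p

/-- The Teichmüller representative `ω(u)` of a `p`-adic unit `u` (`|u|_p = 1`): the canonical projection
`ℤ_p^× → μ_{φ(q_p)}(ℤ_p)` along `ℤ_p^× ≅ μ_{φ(q_p)}(ℤ_p) × (1 + q_p ℤ_p)` — for odd `p` the `(p−1)`-st root of unity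
congruent to `u` mod `p`, computed as `lim_k u^{p^k}`; for `p = 2` the element of `{±1}` congruent to `u` mod `4`. Junk
off the units. [cite: Sprang2020, §3 (p. 8)] [cite: Lai2025TwoAdicZeta, §2.3] -/
def teichmullerUnit (u : ℚ_[p]) : ℚ_[p] :=
  if p = 2 then (if ‖u - 1‖ < 2⁻¹ then 1 else -1) else limUnder atTop fun k : ℕ => u ^ (p ^ k)

/-- `ω(x) := p^{ν_p(x)} ω(x / p^{ν_p(x)})` for `x ∈ ℚ_p^×` (junk at `x = 0`). [cite: Sprang2020, §3 (p. 8)] [cite: Lai2025TwoAdicZeta, §2.3] -/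
def teichmuller (x : ℚ_[p]) : ℚ_[p] :=
  (p : ℚ_[p]) ^ x.valuation * teichmullerUnit p (x * (p : ℚ_[p]) ^ (-x.valuation))

/-- `⟨x⟩ := x / ω(x)` for `x ∈ ℚ_p^×`. [cite: Sprang2020, §3 (p. 8)] [cite: Lai2025TwoAdicZeta, §2.3] -/
def angle (x : ℚ_[p]) : ℚ_[p] := x / teichmuller p x

/-- **The `p`-adic Hurwitz zeta value `ζ_p(s, x)`** for an integer `s ≥ 2` and `x ∈ ℚ_p` with `|x|_p ≥ q_p`:
"`ζ_p(s, x) = (1/(s−1)) ∫_{ℤ_p} ⟨x + t⟩^{1−s} dt`", i.e. (unravelling the Volkenborn integral)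
"`ζ_p(s, x) = (1/(s−1)) lim_{r→∞} p^{−r} Σ_{0≤m<p^r} ⟨x + m⟩^{1−s}`" — rendered by `limUnder atTop` of the Riemann sums
(junk if divergent, for `s ≤ 1`, or off `|x|_p ≥ q_p`). [cite: Sprang2020, §3 (3.1) and proof of Lemma 3.1] [cite: Lai2025TwoAdicZeta, §2.3 (definition of `ζ_p(s,x)`)] -/
def padicHurwitzZeta (s : ℕ) (x : ℚ_[p]) : ℚ_[p] :=
  (1 / ((s : ℚ_[p]) - 1)) *
    limUnder atTop fun r : ℕ =>
      (p : ℚ_[p]) ^ (-(r : ℤ)) * ∑ m ∈ Finset.range (p ^ r), angle p (x + m) ^ (1 - (s : ℤ))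

/-- Unfolding of `ζ_p(s, x)`. [cite: Sprang2020, §3 (proof of Lemma 3.1)] -/
theorem padicHurwitzZeta_def (s : ℕ) (x : ℚ_[p]) :
    padicHurwitzZeta p s x = (1 / ((s : ℚ_[p]) - 1)) *
      limUnder atTop fun r : ℕ =>
        (p : ℚ_[p]) ^ (-(r : ℤ)) * ∑ m ∈ Finset.range (p ^ r), angle p (x + m) ^ (1 - (s : ℤ)) := rfl

/-- For `p = 2` the Teichmüller representative of a unit is `±1`: `1` on `1 + 4ℤ_2`, `−1` otherwise.
[cite: Lai2025TwoAdicZeta, §2.3] -/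
theorem teichmullerUnit_two (u : ℚ_[2]) :
    teichmullerUnit 2 u = if ‖u - 1‖ < 2⁻¹ then 1 else -1 := by
  simp [teichmullerUnit]

/-! ### Named facts -/

/-- **Sprang 2020, Lemma 3.1** (named fact, statement only): "Let `s > 1` be an integer and `x ∈ ℚ_p` with `|x|_p ≥ q_p`,
then `ω(x)^{1−s} ζ_p(s, x) = (1/(s−1)) ∫_{ℤ_p} (x + t)^{1−s} dt`" (since `ω(x + m) = ω(x)` for `m ∈ ℤ`); the integral
rendered as `lim_r p^{−r} Σ_{m<p^r} (x+m)^{1−s}`, asserted to exist. [cite: Sprang2020, Lemma 3.1 (§3)] -/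
def sprang2020_lemma31 : Prop :=
  ∀ (p : ℕ) [Fact p.Prime] (s : ℕ) (x : ℚ_[p]), 1 < s → (qp p : ℝ) ≤ ‖x‖ →
    ∃ V : ℚ_[p],
      Tendsto (fun r : ℕ => (p : ℚ_[p]) ^ (-(r : ℤ)) * ∑ m ∈ Finset.range (p ^ r), (x + m) ^ (1 - (s : ℤ)))
        atTop (𝓝 V) ∧
      teichmuller p x ^ (1 - (s : ℤ)) * padicHurwitzZeta p s x = (1 / ((s : ℚ_[p]) - 1)) * V

/-- **Lai 2025 (2-adic), Lemma 2.7** (named fact, statement only): "For any odd integer `j ≥ 3`, we have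
`ζ_p(j) = (1/q_p) Σ_{a=0, p∤a}^{q_p − 1} ω(a)^{1−j} ζ_p(j, a/q_p)`" (from the definition `ζ_p(j) = L_p(j, ω^{1−j})`,
`L_p(s, χ) = ⟨M⟩^{1−s} M^{−1} Σ_{a, p∤a} χ(a) ζ_p(s, a/M)` with `M = q_p`, and the reflection formula), relating the
`ζ_p(j)` of `Basic.lean` (`padicZetaValue`) to the Hurwitz values. [cite: Lai2025TwoAdicZeta, Lemma 2.7 (§2.3)] -/
def lai2025TwoAdic_lemma27 : Prop :=
  ∀ (p : ℕ) [Fact p.Prime] (j : ℕ), Odd j → 3 ≤ j →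
    padicZetaValue p j =
      (1 / (qp p : ℚ_[p])) * ∑ a ∈ (Finset.range (qp p)).filter (fun a => ¬ p ∣ a),
        teichmuller p (a : ℚ_[p]) ^ (1 - (j : ℤ)) * padicHurwitzZeta p j ((a : ℚ_[p]) / (qp p : ℚ_[p]))

/-- **Lai 2025 (2-adic), Lemma 2.7, `p = 2`** (named fact, statement only): "for any odd integer `j ≥ 3` we have
`ζ_2(j) = ½ ζ_2(j, ¼)`." [cite: Lai2025TwoAdicZeta, Lemma 2.7 (§2.3)] -/
def lai2025TwoAdic_lemma27_two : Prop :=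
  ∀ j : ℕ, Odd j → 3 ≤ j →
    padicZetaValue 2 j = (1 / 2 : ℚ_[2]) * padicHurwitzZeta 2 j ((4 : ℚ_[2])⁻¹)

/-- **Lai 2025 (2-adic), Theorem 1.2** (named fact, statement only): "For any nonnegative integer `s` and any
`δ ∈ {0, 1}`, the following set contains at least one irrational number:
`{ζ_2(j, ¼) | j ∈ ℤ ∩ [s+3, 3s+5], j ≡ δ (mod 2)}`." [cite: Lai2025TwoAdicZeta, Thm 1.2 (§1)] -/
def lai2025TwoAdic_theorem12 : Prop :=
  ∀ s δ : ℕ, δ ≤ 1 →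
    ∃ j : ℕ, s + 3 ≤ j ∧ j ≤ 3 * s + 5 ∧ j % 2 = δ ∧ IsIrrational 2 (padicHurwitzZeta 2 j ((4 : ℚ_[2])⁻¹))

/-- **Lai 2025 (2-adic), Theorem 1.3** (named fact, statement only): "For any nonnegative integer `s`, the following set
contains at least one irrational number: `{ζ_2(j, ¼) | j ∈ ℤ ∩ [s+3, 2s+3]}`." ("The special case `s = 0` … gives an
alternative proof of the irrationality of `ζ_2(3)`", via Lemma 2.7.) [cite: Lai2025TwoAdicZeta, Thm 1.3 (§1)] -/
def lai2025TwoAdic_theorem13 : Prop :=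
  ∀ s : ℕ, ∃ j : ℕ, s + 3 ≤ j ∧ j ≤ 2 * s + 3 ∧ IsIrrational 2 (padicHurwitzZeta 2 j ((4 : ℚ_[2])⁻¹))

/-- **Sprang 2020, Theorem 1.3, case `K = ℚ`** (named fact, statement only): "Let `x ∈ ℚ` with `|x|_p > 1`. For `ε > 0`
and `s` sufficiently large, we have `dim_K(K + ζ_p(2, x) K + ⋯ + ζ_p(s, x) K) ≥ (1 − ε) log s/(2[K:ℚ](1 + log 2))`" — here
`K = ℚ` and `x` on the domain of definition `|x|_p ≥ q_p` of §3 (TODO(general form): number field `K ⊂ ℂ_p`).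
[cite: Sprang2020, Thm 1.3 (§1)] -/
def sprang2020_theorem13_rat : Prop :=
  ∀ (p : ℕ) [Fact p.Prime] (x : ℚ), (qp p : ℝ) ≤ ‖(x : ℚ_[p])‖ →
    ∀ ε : ℝ, 0 < ε → ∃ s₀ : ℕ, ∀ s : ℕ, s₀ ≤ s →
      (1 - ε) * Real.log s / (2 * (1 + Real.log 2)) ≤
        Module.finrank ℚ
          ↥(Submodule.span ℚ
            (insert (1 : ℚ_[p]) {y | ∃ i : ℕ, 2 ≤ i ∧ i ≤ s ∧ y = padicHurwitzZeta p i (x : ℚ_[p])}))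

end Literature.NumberTheory.Irrationality.PAdicZetaValues
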